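import Literature.NumberTheory.LFunctions.ChebotarevDensityNumberField
import Literature.NumberTheory.GaloisRepresentations.DegreeOnePrimesFrobeniusRel
import Literature.NumberTheory.GaloisRepresentations.DegreeOnePrimesFrobenius
import HarnessLib

/-!
# Push-down of the density of a Frobenius fibre from the fixed field of an element (base `ℚ`)

Topic `Literature/NumberTheory/LFunctions`; namespace `Literature.NumberTheory.LFunctions.Chebotarev`.
Everything in this file is PROVED (theorems only).  This is the density form of the reduction
step common to Deuring's and Chebotarev's proofs of the density theorem (Neukirch, *Algebraic
Number Theory*, VII (13.4), p. 545; M. Deuring, Math. Ann. 110 (1935); in Chebotarev's own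
argument, Stevenhagen–Lenstra, *Chebotarëv and his density theorem* (1996), it is applied to the
fixed field of an auxiliary element `h` of `Gal(L(ζ_ℓ)/ℚ)` over which `L(ζ_ℓ)` is cyclotomic):

**`hasStrongDirichletDensity_primesOfFrobClass_of_intermediateField`.** Let `N/ℚ` be finite
Galois with group `G`, `E ⊆ N` an intermediate field with `H = Gal(N/E)` commutative, and
`h ∈ H` (given as `h' : N ≃ₐ[E] N` with `h'|_ℚ = h`).  If the set of primes `𝔔` of `E`,
unramified in `N`, all of whose `E`-Frobenii equal `h'` has strong Dirichlet density `1/[N:E]`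
(the conclusion of the Dirichlet–Chebotarev theorem for the abelian extension `N/E` and the
element `h'`), then the set `P_{N|ℚ}(h)` of rational primes whose Frobenius class is the class of
`h` (`primesOfFrobClass ℚ N h`, `ChebotarevDensityNumberField.lean`) has strong Dirichlet density
`#⟨h⟩ / #G`.

Proof ("to be verified via direct computation", Neukirch loc. cit.): only primes of degree one
matter for strong densities (`Literature.NumberTheory.LFunctions.hasStrongDirichletDensity_of_primeNormCount_eq`, which moreover
tolerates finitely many exceptional rational primes — here the primes ramified in `N`); a prime
`𝔔` of `E` of prime norm `p` lies over `v_p` with residue degree one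
(`absNorm_eq_iff_under_eq_and_inertiaDeg_eq_one`), and at such `𝔔` the conditions "every
`E`-Frobenius above `𝔔` is `h'`" and "every `ℚ`-Frobenius above `𝔔` is `h`" agree
(`forall_isArithFrobAt_eq_iff_of_inertiaDeg_eq_one`, from the tree's `FrobeniusDensityTheorem`
lemmas on Frobenius and the splitting in an intermediate field); the number of such `𝔔` above
`p ∉ Ram(N/ℚ)` is `#{x ∈ G : x F_p x⁻¹ = h} / #H` by the relative Deuring count
(`GaloisRepresentations.DegreeOnePrimesRel.card_mul_card_frob_eq_card_conj_eq`), i.e.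
`#C_G(h)/#H` or `0` according as `F_p ∼ h` or not; and `#C_G(h) · #⟨h⟩ = #G`
(`card_setOf_isConj_mul_card_centralizer`).  The ramification condition over `E` in the
hypothesis is removed first (finitely many exceptions, `finite_setOf_not_isUnramifiedIn`).

Also: `primeNormCount_rat` (over `ℚ` the prime-norm count of a set of primes is the indicator of
`v_p`), `absNorm_eq_primesEquiv`, `primeNormCount_eq_natCard`,
`natCard_absNorm_eq_eq_natCard_primesOver`.

## References

* J. Neukirch, *Algebraic Number Theory*, Springer 1999, VII (13.4) and its proof, (13.6).
  [NeukirchANT1999]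
* M. Deuring, *Über den Tschebotareffschen Dichtigkeitssatz*, Math. Ann. 110 (1935), 414–415.
* P. Stevenhagen, H. W. Lenstra, *Chebotarëv and his density theorem*, Math. Intelligencer 18
  (1996), no. 2, 26–37. [StevenhagenLenstra1996]
-/

noncomputable section

open Filter NumberField IsDedekindDomain Ideal Rat.HeightOneSpectrum
open scoped Topology Classical Pointwise

namespace Literature.NumberTheory.LFunctions.Chebotarev

/-! ### Group theory: class equation for one class -/

section Group

variable {G : Type*} [Group G]

/-- **One term of the class equation**: `#⟨h⟩ · #C_G(h) = #G` (orbit–stabiliser for the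
conjugation action, Mathlib `MulAction.index_stabilizer`, `ConjAct`). [folklore] -/
theorem card_setOf_isConj_mul_card_centralizer (h : G) :
    Nat.card {τ : G | IsConj h τ} * Nat.card (Subgroup.centralizer ({h} : Set G)) = Nat.card G := by
  have h1 : {τ : G | IsConj h τ} = MulAction.orbit (ConjAct G) h := by
    ext τ
    rw [Set.mem_setOf_eq, ConjAct.mem_orbit_conjAct, isConj_comm]
  have hiff : ∀ g : G, ConjAct.toConjAct g ∈ MulAction.stabilizer (ConjAct G) h ↔
      g ∈ Subgroup.centralizer ({h} : Set G) := by
    intro g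
    rw [MulAction.mem_stabilizer_iff, ConjAct.smul_def, ConjAct.ofConjAct_toConjAct,
      Subgroup.mem_centralizer_iff]
    simp only [Set.mem_singleton_iff, forall_eq]
    rw [mul_inv_eq_iff_eq_mul]
    exact ⟨fun e ↦ e.symm, fun e ↦ e.symm⟩
  have h2 : Nat.card (MulAction.stabilizer (ConjAct G) h) =
      Nat.card (Subgroup.centralizer ({h} : Set G)) := by
    refine Nat.card_congr
      { toFun := fun k ↦ ⟨ConjAct.ofConjAct k.1, (hiff (ConjAct.ofConjAct k.1)).mp k.2⟩
        invFun := fun g ↦ ⟨ConjAct.toConjAct g.1, (hiff _).mpr g.2⟩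
        left_inv := fun _ ↦ rfl
        right_inv := fun _ ↦ rfl }
  rw [h1, Nat.card_coe_set_eq, ← MulAction.index_stabilizer, ← h2, Subgroup.index_mul_card]
  rfl

end Group

/-! ### Frobenius conditions over an intermediate field vs. over the base -/

section Relative

variable {M N : Type*} [Field M] [NumberField M] [Field N] [NumberField N] [Algebra M N]
  [IsGalois M N] (E : IntermediateField M N)

/-- **Frobenius conditions over `E` and over `M` agree at degree-one primes.** Let `N/M` be
Galois, `E` an intermediate field, `q` a prime of `M` unramified in `N`, `𝔑 ∣ q` a prime of `N`
with `f(𝔑 ∩ E | q) = 1`, and `h' ∈ Gal(N/E)` with restriction `h ∈ Gal(N/M)`.  Then every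
`E`-Frobenius at `𝔑` equals `h'` iff every `M`-Frobenius at `𝔑` equals `h`: the residue fields
of `q` and `𝔑 ∩ E` have the same size (`card_quotient_under_eq_of_inertiaDeg_eq_one`), so the two
Frobenius congruences coincide, and an `M`-Frobenius at `𝔑` automatically lies in `Gal(N/E)`
(`mem_fixingSubgroup_of_inertiaDeg_under_eq_one`).  [cite: Marcus2018, Ch. 4, Thm. 28–29 and Ex. 11] -/
theorem forall_isArithFrobAt_eq_iff_of_inertiaDeg_eq_one {q : HeightOneSpectrum (𝓞 M)}
    (hunr : Algebra.IsUnramifiedIn (𝓞 N) q.asIdeal) {𝔑 : Ideal (𝓞 N)}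
    (h𝔑 : 𝔑 ∈ q.asIdeal.primesOver (𝓞 N)) (hf : (𝔑.under (𝓞 E)).inertiaDeg (𝓞 M) = 1)
    {h : N ≃ₐ[M] N} {h' : N ≃ₐ[E] N} (hh' : h'.restrictScalars M = h) :
    (∀ φ' : N ≃ₐ[E] N, IsArithFrobAt (𝓞 E) φ' 𝔑 → φ' = h') ↔
      (∀ σ : N ≃ₐ[M] N, IsArithFrobAt (𝓞 M) σ 𝔑 → σ = h) := by
  haveI : NumberField E := NumberField.of_module_finite M E
  haveI := h𝔑.1
  haveI := h𝔑.2
  have hcard : Nat.card (𝓞 E ⧸ 𝔑.under (𝓞 E)) = Nat.card (𝓞 M ⧸ 𝔑.under (𝓞 M)) := by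
    rw [GaloisRepresentations.card_quotient_under_eq_of_inertiaDeg_eq_one E h𝔑 hf, ← h𝔑.2.over]
  set eE : E.fixingSubgroup ≃* (N ≃ₐ[E] N) := IntermediateField.fixingSubgroupEquiv E with heE
  -- Frobenius over `E` and over `M` are the same condition at `𝔑`
  have key : ∀ φ' : N ≃ₐ[E] N,
      IsArithFrobAt (𝓞 E) φ' 𝔑 ↔ IsArithFrobAt (𝓞 M) (φ'.restrictScalars M) 𝔑 := by
    intro φ'
    constructor
    · intro H x
      have h1 := H x
      rw [hcard, MulSemiringAction.toAlgHom_apply] at h1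
      rw [MulSemiringAction.toAlgHom_apply, GaloisRepresentations.RingOfIntegers.restrictScalars_smul]
      exact h1
    · intro H x
      have h1 := H x
      rw [MulSemiringAction.toAlgHom_apply, GaloisRepresentations.RingOfIntegers.restrictScalars_smul] at h1
      rw [hcard, MulSemiringAction.toAlgHom_apply]
      exact h1
  have hres : ∀ φ' : N ≃ₐ[E] N, ((eE.symm φ' : E.fixingSubgroup) : N ≃ₐ[M] N) =
      φ'.restrictScalars M := fun _ ↦ rfl
  have hh : h ∈ E.fixingSubgroup := by
    rw [← hh', ← hres]
    exact (eE.symm h').2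
  have hh'e : eE.symm h' = ⟨h, hh⟩ := Subtype.ext (by rw [hres, hh'])
  constructor
  · intro H σ hσ
    have hσE : σ ∈ E.fixingSubgroup :=
      GaloisRepresentations.mem_fixingSubgroup_of_inertiaDeg_under_eq_one E hunr h𝔑 hσ hf
    set φ' : N ≃ₐ[E] N := eE ⟨σ, hσE⟩ with hφ'
    have hφ'σ : φ'.restrictScalars M = σ := by
      rw [← hres, hφ', MulEquiv.symm_apply_apply]
    have h1 : IsArithFrobAt (𝓞 E) φ' 𝔑 := (key φ').mpr (hφ'σ ▸ hσ)
    have h2 := H φ' h1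
    rw [← hφ'σ, h2, hh']
  · intro H φ' hφ'
    have h1 := H _ ((key φ').mp hφ')
    apply eE.symm.injective
    rw [hh'e]
    exact Subtype.ext (by rw [hres, h1])

omit [NumberField M] [NumberField N] [IsGalois M N] in
/-- If `h' ∈ Gal(N/E)` restricts to `h ∈ Gal(N/M)` then `h` fixes `E`. [folklore] -/
theorem mem_fixingSubgroup_of_restrictScalars_eq {h : N ≃ₐ[M] N} {h' : N ≃ₐ[E] N}
    (hh' : h'.restrictScalars M = h) : h ∈ E.fixingSubgroup := by
  rw [← hh', IntermediateField.mem_fixingSubgroup_iff]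
  intro x hx
  exact h'.commutes ⟨x, hx⟩

end Relative

/-! ### Counting over `ℚ` -/

section RatCount

/-- The absolute norm of a nonzero prime `v` of `𝓞 ℚ` is the rational prime `p_v` corresponding
to it under Mathlib's `Rat.HeightOneSpectrum.primesEquiv` (`𝓞 ℚ ⧸ v ≃ ℤ ⧸ (p_v) ≃ ZMod p_v`).
[folklore] -/
theorem absNorm_eq_primesEquiv (v : HeightOneSpectrum (𝓞 ℚ)) :
    absNorm v.asIdeal = ((primesEquiv v : Nat.Primes) : ℕ) := by
  change absNorm v.asIdeal = natGenerator v
  rw [absNorm_apply, Submodule.cardQuot_apply]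
  have e : 𝓞 ℚ ⧸ v.asIdeal ≃+* ℤ ⧸ Ideal.span {(natGenerator v : ℤ)} :=
    Ideal.quotientEquiv _ _ (Rat.IsIntegralClosure.intEquiv (𝓞 ℚ)) (span_natGenerator v)
  rw [Nat.card_congr (e.trans (Int.quotientSpanNatEquivZMod _)).toEquiv, Nat.card_zmod]

/-- `N(v) = p` iff `v` is the prime `v_p` of `𝓞 ℚ` corresponding to `p`. [folklore] -/
theorem absNorm_eq_iff_eq_primesEquiv_symm {v : HeightOneSpectrum (𝓞 ℚ)} {p : Nat.Primes} :
    absNorm v.asIdeal = p ↔ v = primesEquiv.symm p := by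
  rw [absNorm_eq_primesEquiv, Equiv.eq_symm_apply]
  exact ⟨fun h ↦ Subtype.ext h, fun h ↦ congrArg Subtype.val h⟩

/-- **Over `ℚ` the prime-norm count of a set `X` of primes at `p` is `1_X(v_p)`** (there is
exactly one prime of `𝓞 ℚ` of norm `p`). [folklore] -/
theorem primeNormCount_rat (X : Set (HeightOneSpectrum (𝓞 ℚ))) (p : Nat.Primes) :
    primeNormCount ℚ X p = if primesEquiv.symm p ∈ X then 1 else 0 := by
  rw [primeNormCount]
  have h1 : primesOfNorm ℚ (p : ℕ) = {primesEquiv.symm p} := by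
    ext v
    rw [mem_primesOfNorm, Finset.mem_singleton, absNorm_eq_iff_eq_primesEquiv_symm]
  rw [h1, Finset.filter_singleton]
  by_cases h : primesEquiv.symm p ∈ X
  · rw [if_pos h, if_pos h, Finset.card_singleton]
  · rw [if_neg h, if_neg h, Finset.card_empty]

/-- The prime-norm count `#{v ∈ S : N v = p}` as the cardinality of a subtype. [folklore] -/
theorem primeNormCount_eq_natCard (K : Type*) [Field K] [NumberField K]
    (S : Set (HeightOneSpectrum (𝓞 K))) (p : ℕ) :
    primeNormCount K S p = Nat.card {v : HeightOneSpectrum (𝓞 K) // absNorm v.asIdeal = p ∧ v ∈ S} := by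
  rw [primeNormCount, ← Fintype.card_coe, ← Nat.card_eq_fintype_card]
  refine Nat.card_congr (Equiv.subtypeEquivRight fun v ↦ ?_)
  rw [Finset.mem_filter, mem_primesOfNorm]

variable {N : Type} [Field N] [NumberField N] [IsGalois ℚ N] (E : IntermediateField ℚ N)

omit [IsGalois ℚ N] in
/-- A nonzero prime `𝔔` of a number field `E` has prime absolute norm `p` iff it lies over `v_p`
with residue degree `f(𝔔 | v_p) = 1` (`N 𝔔 = N(𝔔 ∩ ℚ)^{f}`, Mathlib `Ideal.absNorm_pow_inertiaDeg`).
[folklore] -/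
theorem absNorm_eq_iff_under_eq_and_inertiaDeg_eq_one [NumberField E] (𝔔 : HeightOneSpectrum (𝓞 E))
    (p : Nat.Primes) :
    absNorm 𝔔.asIdeal = p ↔
      𝔔.under (𝓞 ℚ) = primesEquiv.symm p ∧ 𝔔.asIdeal.inertiaDeg (𝓞 ℚ) = 1 := by
  set v : HeightOneSpectrum (𝓞 ℚ) := 𝔔.under (𝓞 ℚ) with hvdef
  haveI : 𝔔.asIdeal.LiesOver v.asIdeal := ⟨rfl⟩
  have hpow : absNorm 𝔔.asIdeal = ((primesEquiv v : Nat.Primes) : ℕ) ^ 𝔔.asIdeal.inertiaDeg (𝓞 ℚ) := by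
    rw [← absNorm_eq_primesEquiv, Ideal.absNorm_pow_inertiaDeg v.asIdeal 𝔔.asIdeal]
  rw [hpow, Nat.Prime.pow_eq_iff p.2, ← absNorm_eq_primesEquiv, absNorm_eq_iff_eq_primesEquiv_symm]

omit [IsGalois ℚ N] in
/-- Counting reformulation: the nonzero primes of `E` of norm `p` satisfying `P` are in bijection
with the primes of `𝓞 E` over `v_p` of residue degree one satisfying `P`. [folklore] -/
theorem natCard_absNorm_eq_eq_natCard_primesOver [NumberField E] (p : Nat.Primes)
    (P : Ideal (𝓞 E) → Prop) :
    Nat.card {𝔔 : HeightOneSpectrum (𝓞 E) // absNorm 𝔔.asIdeal = p ∧ P 𝔔.asIdeal} =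
      Nat.card {P' : ((primesEquiv (R := 𝓞 ℚ)).symm p).asIdeal.primesOver (𝓞 E) //
        P'.1.inertiaDeg (𝓞 ℚ) = 1 ∧ P P'.1} := by
  set q : HeightOneSpectrum (𝓞 ℚ) := primesEquiv.symm p with hq
  refine Nat.card_congr
    { toFun := fun 𝔔 ↦ ⟨⟨𝔔.1.asIdeal, 𝔔.1.isPrime, ?_⟩, ?_⟩
      invFun := fun P' ↦ ⟨⟨P'.1.1, P'.1.2.1, ?_⟩, ?_⟩
      left_inv := fun _ ↦ rfl
      right_inv := fun _ ↦ rfl }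
  · -- lies over `q`
    have h := ((absNorm_eq_iff_under_eq_and_inertiaDeg_eq_one E 𝔔.1 p).mp 𝔔.2.1).1
    exact ⟨congrArg HeightOneSpectrum.asIdeal h.symm⟩
  · have h := (absNorm_eq_iff_under_eq_and_inertiaDeg_eq_one E 𝔔.1 p).mp 𝔔.2.1
    exact ⟨h.2, 𝔔.2.2⟩
  · exact ne_bot_of_mem_primesOver q.ne_bot P'.1.2
  · refine ⟨(absNorm_eq_iff_under_eq_and_inertiaDeg_eq_one E ⟨P'.1.1, P'.1.2.1, _⟩ p).mpr
      ⟨?_, P'.2.1⟩, P'.2.2⟩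
    haveI := P'.1.2.2
    apply HeightOneSpectrum.ext
    rw [HeightOneSpectrum.under_asIdeal]
    exact (P'.1.2.2.over).symm

end RatCount

/-! ### The push-down -/

section PushDown

variable {N : Type} [Field N] [NumberField N] [IsGalois ℚ N] (E : IntermediateField ℚ N)

/-- **Push-down of the density of a Frobenius fibre from an intermediate field with abelian
group.**  Let `N/ℚ` be Galois with group `G`, `E ⊆ N` an intermediate field with `H = Gal(N/E)`
commutative, `h' ∈ Gal(N/E)` with restriction `h ∈ G`.  If
`{𝔔 prime of E : 𝔔 unramified in N, every E-Frobenius above 𝔔 equals h'}` has strong Dirichlet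
density `1/[N:E]`, then `P_{N|ℚ}(h) = {p unramified : Frob_p ∼ h}` has strong Dirichlet density
`#⟨h⟩/#G`.  (Deuring's reduction in density form; with `E = N^{⟨h⟩}` this is the step
"`d(P_{L|K}(σ)) = #⟨σ⟩/(f·#Z)·…`" of Neukirch's proof of (13.4), and the push-down step of
Chebotarev's crossing argument.) [cite: NeukirchANT1999, VII (13.4) proof, p. 545] -/
theorem hasStrongDirichletDensity_primesOfFrobClass_of_intermediateField [NumberField E]
    [IsMulCommutative E.fixingSubgroup] {h : N ≃ₐ[ℚ] N} {h' : N ≃ₐ[E] N}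
    (hh' : h'.restrictScalars ℚ = h)
    (hY : HasStrongDirichletDensity E
      {𝔔 : HeightOneSpectrum (𝓞 E) | Algebra.IsUnramifiedIn (𝓞 N) 𝔔.asIdeal ∧
        ∀ 𝔑 ∈ 𝔔.asIdeal.primesOver (𝓞 N), ∀ φ' : N ≃ₐ[E] N,
          IsArithFrobAt (𝓞 E) φ' 𝔑 → φ' = h'}
      (1 / Module.finrank E N)) :
    HasStrongDirichletDensity ℚ (primesOfFrobClass ℚ N h)
      ((Nat.card {τ : N ≃ₐ[ℚ] N | IsConj h τ} : ℝ) / Nat.card (N ≃ₐ[ℚ] N)) := by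
  have hh : h ∈ E.fixingSubgroup := mem_fixingSubgroup_of_restrictScalars_eq E hh'
  set H : Subgroup (N ≃ₐ[ℚ] N) := E.fixingSubgroup with hHdef
  haveI : IsGalois E N := IsGalois.tower_top_of_isGalois ℚ E N
  have hHcard : (Module.finrank E N : ℝ) = Nat.card H := by
    rw [hHdef, Nat.card_congr (IntermediateField.fixingSubgroupEquiv E).toEquiv,
      IsGalois.card_aut_eq_finrank]
  rw [hHcard] at hY
  have hHpos : (0 : ℝ) < Nat.card H := by exact_mod_cast Nat.card_pos
  have hCpos : (0 : ℝ) < Nat.card (Subgroup.centralizer ({h} : Set (N ≃ₐ[ℚ] N))) := by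
    exact_mod_cast Nat.card_pos
  have hclpos : (0 : ℝ) < Nat.card {τ : N ≃ₐ[ℚ] N | IsConj h τ} := by
    have : Nonempty {τ : N ≃ₐ[ℚ] N | IsConj h τ} := ⟨⟨h, IsConj.refl h⟩⟩
    exact_mod_cast Nat.card_pos
  -- Step 0: drop the ramification condition over `E` (finitely many exceptions)
  set cond : HeightOneSpectrum (𝓞 E) → Prop := fun 𝔔 ↦
    ∀ 𝔑 ∈ 𝔔.asIdeal.primesOver (𝓞 N), ∀ φ' : N ≃ₐ[E] N, IsArithFrobAt (𝓞 E) φ' 𝔑 → φ' = h'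
    with hcond
  have hY₀ : HasStrongDirichletDensity E {𝔔 | cond 𝔔} (1 / Nat.card H) := by
    refine hY.of_finite_symmDiff (GaloisRepresentations.finite_setOf_not_isUnramifiedIn E N) ?_
    intro 𝔔 h𝔔
    simp only [Set.mem_setOf_eq, not_not] at h𝔔
    simp only [Set.mem_setOf_eq]
    exact ⟨fun hc ↦ hc.2, fun hc ↦ ⟨h𝔔, hc⟩⟩
  -- Step 1: the count relation at the unramified primes
  set a : ℝ := (Nat.card (Subgroup.centralizer ({h} : Set (N ≃ₐ[ℚ] N))) : ℝ) / Nat.card H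
    with ha
  have ha0 : a ≠ 0 := div_ne_zero hCpos.ne' hHpos.ne'
  have hbad : {p : Nat.Primes |
      ¬ Algebra.IsUnramifiedIn (𝓞 N) ((primesEquiv (R := 𝓞 ℚ)).symm p).asIdeal}.Finite := by
    have hfin := GaloisRepresentations.finite_setOf_not_isUnramifiedIn ℚ N
    refine (hfin.image (primesEquiv (R := 𝓞 ℚ))).subset ?_
    intro p hp
    exact ⟨primesEquiv.symm p, hp, Equiv.apply_symm_apply _ _⟩
  have hcount : ∀ᶠ p : Nat.Primes in cofinite,
      (primeNormCount E {𝔔 | cond 𝔔} p : ℝ) = a * primeNormCount ℚ (primesOfFrobClass ℚ N h) p := by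
    refine Filter.eventually_of_mem hbad.compl_mem_cofinite fun p hp ↦ ?_
    simp only [Set.mem_compl_iff, Set.mem_setOf_eq, not_not] at hp
    set q : HeightOneSpectrum (𝓞 ℚ) := primesEquiv.symm p with hq
    -- a Frobenius above `q`
    obtain ⟨Q₀, hQ₀, F₀, hF₀⟩ := exists_isArithFrobAt_of_heightOneSpectrum (K := ℚ) (L := N) q
    -- left side via the relative Deuring count
    have hL : Nat.card H * primeNormCount E {𝔔 | cond 𝔔} p =
        Nat.card {x : N ≃ₐ[ℚ] N // x * F₀ * x⁻¹ = h} := by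
      rw [primeNormCount_eq_natCard]
      have h1 : Nat.card {𝔔 : HeightOneSpectrum (𝓞 E) // absNorm 𝔔.asIdeal = p ∧ 𝔔 ∈ {𝔔 | cond 𝔔}} =
          Nat.card {𝔔 : HeightOneSpectrum (𝓞 E) // absNorm 𝔔.asIdeal = p ∧
            ∀ 𝔑 : Ideal (𝓞 N), 𝔑.IsPrime → 𝔑.LiesOver 𝔔.asIdeal →
              ∀ σ : N ≃ₐ[ℚ] N, IsArithFrobAt (𝓞 ℚ) σ 𝔑 → σ = h} := by
        refine Nat.card_congr (Equiv.subtypeEquivRight fun 𝔔 ↦ ?_)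
        refine and_congr_right fun hN ↦ ?_
        have hdeg := (absNorm_eq_iff_under_eq_and_inertiaDeg_eq_one E 𝔔 p).mp hN
        simp only [Set.mem_setOf_eq, hcond]
        constructor
        · intro hc 𝔑 h𝔑p h𝔑o σ hσ
          haveI := h𝔑p
          haveI := h𝔑o
          have h𝔑q : 𝔑 ∈ q.asIdeal.primesOver (𝓞 N) := by
            refine ⟨h𝔑p, ⟨?_⟩⟩
            rw [← Ideal.under_under (B := 𝓞 E) 𝔑, ← h𝔑o.over]
            exact congrArg HeightOneSpectrum.asIdeal hdeg.1.symm
          have hf : (𝔑.under (𝓞 E)).inertiaDeg (𝓞 ℚ) = 1 := by rw [← h𝔑o.over]; exact hdeg.2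
          exact (forall_isArithFrobAt_eq_iff_of_inertiaDeg_eq_one E hp h𝔑q hf hh').mp
            (hc 𝔑 ⟨h𝔑p, h𝔑o⟩) σ hσ
        · intro hc 𝔑 h𝔑 φ' hφ'
          haveI := h𝔑.1
          haveI := h𝔑.2
          have h𝔑q : 𝔑 ∈ q.asIdeal.primesOver (𝓞 N) := by
            refine ⟨h𝔑.1, ⟨?_⟩⟩
            rw [← Ideal.under_under (B := 𝓞 E) 𝔑, ← h𝔑.2.over]
            exact congrArg HeightOneSpectrum.asIdeal hdeg.1.symm
          have hf : (𝔑.under (𝓞 E)).inertiaDeg (𝓞 ℚ) = 1 := by rw [← h𝔑.2.over]; exact hdeg.2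
          exact (forall_isArithFrobAt_eq_iff_of_inertiaDeg_eq_one E hp h𝔑q hf hh').mpr
            (hc 𝔑 h𝔑.1 h𝔑.2) φ' hφ'
      rw [h1, natCard_absNorm_eq_eq_natCard_primesOver E p (fun I ↦
        ∀ 𝔑 : Ideal (𝓞 N), 𝔑.IsPrime → 𝔑.LiesOver I →
          ∀ σ : N ≃ₐ[ℚ] N, IsArithFrobAt (𝓞 ℚ) σ 𝔑 → σ = h)]
      exact GaloisRepresentations.DegreeOnePrimesRel.card_mul_card_frob_eq_card_conj_eq E hp hQ₀ hF₀ hh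
    -- right side: indicator of `q ∈ P(h)`
    have hR : primeNormCount ℚ (primesOfFrobClass ℚ N h) p = if IsConj F₀ h then 1 else 0 := by
      rw [primeNormCount_rat]
      have : primesEquiv.symm p ∈ primesOfFrobClass ℚ N h ↔ IsConj F₀ h := by
        constructor
        · intro hmem
          exact (isConj_of_mem_primesOfFrobClass hmem hQ₀ hF₀).symm
        · intro hc
          obtain ⟨x, rfl⟩ := isConj_iff.mp hc
          exact ⟨hp, x • Q₀, GaloisRepresentations.DegreeOnePrimesRel.smul_mem_primesOver hQ₀ x,
            hF₀.conj x⟩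
      by_cases hc : IsConj F₀ h
      · rw [if_pos hc, if_pos (this.mpr hc)]
      · rw [if_neg hc, if_neg (fun hm ↦ hc (this.mp hm))]
    -- combine
    have hL' : (primeNormCount E {𝔔 | cond 𝔔} p : ℝ) =
        (Nat.card {x : N ≃ₐ[ℚ] N // x * F₀ * x⁻¹ = h} : ℝ) / Nat.card H := by
      rw [eq_div_iff hHpos.ne', mul_comm]
      exact_mod_cast hL
    rw [hL', hR, ha]
    by_cases hc : IsConj F₀ h
    · rw [GaloisRepresentations.DegreeOnePrimes.card_conj_eq_of_isConj hc, if_pos hc]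
      push_cast
      ring
    · rw [GaloisRepresentations.DegreeOnePrimes.card_conj_eq_zero_of_not_isConj hc, if_neg hc]
      push_cast
      ring
  -- Step 2: transfer and identify the density
  have hdens := hasStrongDirichletDensity_of_primeNormCount_eq (M := ℚ) ha0 hY₀ hcount
  have hclass := card_setOf_isConj_mul_card_centralizer h
  have hid : 1 / (Nat.card H : ℝ) / a =
      (Nat.card {τ : N ≃ₐ[ℚ] N | IsConj h τ} : ℝ) / Nat.card (N ≃ₐ[ℚ] N) := by
    rw [← hclass, ha]
    push_cast
    field_simp
  rw [hid] at hdens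
  exact hdens

end PushDown

end Literature.NumberTheory.LFunctions.Chebotarev
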